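import Literature.AlgebraicGeometry.Resolution.FundamentalLocus
import Literature.AlgebraicGeometry.Resolution.ExceptionalLocusPurity
import HarnessLib

/-!
# Crux `NoZenoR` (stmt-ResolutionOfSingularities-19943) — Zariski's Main Theorem, global finite-fibre form:
# a proper birational morphism with FINITE FIBRES onto a normal integral scheme is an isomorphism

Route `ResolutionOfSingularities/HomologicalConductor` (cell decomp-res, hand leafhand-res-homologicalconduct-16 g3).
OURS: AI-written bookkeeping over tree theorems, weaker than expert review; nothing here is a statement of the
manuscript under review (Hironaka 2017).  SUPPORT level, counted 0.  Def-free, no new named facts.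

Input (i) of the one-blow-up descent (D) of `…NoZenoRMinimalOfDescent` (rigidity of a morphism that contracts the
exceptional curve: the closure of its graph is proper birational over the blown-down surface with finite fibres, hence
an isomorphism).  The tree has the LOCAL statement `exists_isIso_morphismRestrict_of_finite_preimage_singleton`
(a finite fibre over a normal point gives an isomorphism over a neighbourhood); here it is globalised through the iso
locus (`Scheme.Hom.isoLocus`, `IsZariskiLocalAtTarget` for isomorphisms):

* `isIso_of_isProper_of_isBirational_of_finite_preimage` — `g : T → Y` proper birational between integral schemes,
  `Y` with integrally closed local rings, all fibres finite ⇒ `g` is an isomorphism;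
* `isIso_of_isProper_of_isBirational_of_finite_preimage_of_isRegular` — the same for `Y` regular.

No crux or summit statement is proved here.
-/

noncomputable section

-- single-problem summit: the doubled namespace component `ResolutionOfSingularities` is forced
set_option linter.dupNamespace false

open CategoryTheory AlgebraicGeometry TopologicalSpace

universe u

namespace Summit.ResolutionOfSingularities.ResolutionOfSingularities.Theorems.NoZeno.ExcCount.FirstKind

open Literature.AlgebraicGeometry.Resolution

/-- **Zariski's Main Theorem, global finite-fibre form.**  Let `g : T → Y` be a proper birational morphism of integral
schemes, `Y` with integrally closed local rings.  If every fibre `g⁻¹(y)` is finite, `g` is an isomorphism: each `y` has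
a neighbourhood over which `g` is an isomorphism (`exists_isIso_morphismRestrict_of_finite_preimage_singleton`: proper
with finite fibre ⇒ finite near `y` (Stacks 02UP) ⇒ isomorphism near the normal point `y`), so the iso locus is all of
`Y`, and being an isomorphism is Zariski-local on the target.
[cite: StacksProject, Tag 02LQ]; [cite: GortzWedhorn2020, Cor. 12.88] -/
theorem isIso_of_isProper_of_isBirational_of_finite_preimage {T Y : Scheme.{u}} [IsIntegral T]
    [IsIntegral Y] (g : T ⟶ Y) [IsProper g] (hg : IsBirational g)
    (hnorm : ∀ y : Y, IsIntegrallyClosed (Y.presheaf.stalk y)) (hfin : ∀ y : Y, (g ⁻¹' {y}).Finite) :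
    IsIso g := by
  -- every point lies in the iso locus
  have htop : g.isoLocus = ⊤ := by
    refine top_le_iff.mp fun y _ => ?_
    obtain ⟨V, hyV, hV⟩ := exists_isIso_morphismRestrict_of_finite_preimage_singleton g hg ⊤
      (fun y _ => hnorm y) (Opens.mem_top y) (hfin y)
    exact (mem_isoLocus_iff g).mpr ⟨V, hyV, hV⟩
  -- isomorphisms are Zariski-local on the target: use the cover by all the opens of the iso locus
  let ι := {V : Y.Opens // IsIso (g ∣_ V)}
  let U : ι → Y.Opens := fun V => V.1
  have hcov : ⨆ i, U i = ⊤ := htop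
  have key : MorphismProperty.isomorphisms Scheme g :=
    (IsZariskiLocalAtTarget.iff_of_iSup_eq_top (P := MorphismProperty.isomorphisms Scheme) _ hcov).mpr
      fun i : ι => show IsIso (g ∣_ U i) from i.2
  exact key

/-- **The same onto a REGULAR integral scheme** (regular local rings are integrally closed domains).
[cite: StacksProject, Tag 02LQ] -/
theorem isIso_of_isProper_of_isBirational_of_finite_preimage_of_isRegular {T Y : Scheme.{u}} [IsIntegral T]
    [IsIntegral Y] (g : T ⟶ Y) [IsProper g] (hg : IsBirational g)
    (hY : ∀ y : Y, IsRegularLocalRing (Y.presheaf.stalk y)) (hfin : ∀ y : Y, (g ⁻¹' {y}).Finite) :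
    IsIso g := by
  have hnorm : ∀ y : Y, IsIntegrallyClosed (Y.presheaf.stalk y) := fun y => by
    haveI := isDomain_of_isRegularLocalRing (Y.presheaf.stalk y)
    haveI := uniqueFactorizationMonoid_of_isRegularLocalRing (Y.presheaf.stalk y) (hY y)
    infer_instance
  exact isIso_of_isProper_of_isBirational_of_finite_preimage g hg hnorm hfin

end Summit.ResolutionOfSingularities.ResolutionOfSingularities.Theorems.NoZeno.ExcCount.FirstKind

end
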